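import Literature.InformationTheory.QuantumCodes.SubsystemCodes
import Literature.InformationTheory.QuantumCodes.LocalCodeLogicalOperatorTradeoff
import HarnessLib

/-!
# Bravyi 2011, `kd = O(n)` for subsystem codes with local gauge generators (Eq. (2)), and Haah–Preskill 2012
# Theorem 1 for subsystem codes — proofs on the `D`-dimensional torus

Sources (read via `lit`).

* S. Bravyi, *Subsystem codes with spatially local generators*, Phys. Rev. A 83 (2011) 012320 = arXiv:1008.1029
  [Bravyi2011Subsystem]. §1 (chunk p0004 L16–21): «Our second result is a new upper bound on the parameters of 2D
  subsystem codes whose gauge group has spatially local generators, namely, `kd = O(n)` [Eq. (2)].» §8 (p0013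
  L1–26): «the support of any generator of the gauge group `𝒢` can be covered by a square block of size `r × r` …
  The region `A` consists of square blocks `A_1,…,A_m` of size `R × R` with `R = Ω(d)` such that `l(A_i) = 0`
  [Lemma 4, holographic principle]. We choose the separation between adjacent blocks in `A` at least `r` such that
  any generator of `𝒢` overlaps with at most one block in `A`. We claim that `l_bare(A) = 0`. … Since any generator of
  `𝒢` overlaps with at most one block in `A`, we have `P_i ∈ 𝒞(𝒢)` for all `i` … Applying Lemma 2 we get
  `l(B) = 2k`. However, a subset `B` can support at most `2|B|` independent Pauli operators which implies
  `2|B| ≥ l(B)`, that is, `|B| ≥ k`. Simple algebra shows that `|B| = O(n/R) = O(n/d)` and thus `kd = O(n)`.»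
* J. Haah, J. Preskill, arXiv:1011.3529 [HaahPreskill2012]. §4 Lemma 4 (chunk p0007 L11–28): «(Expansion Lemma
  for local subsystem codes) For a local subsystem code, if `M` and `A` are both correctable, where `A` contains
  `∂M`, then `M ∪ A` is correctable.» Lemma 5 (p0007 L29–40): «(Holographic Principle for local subsystem codes) …
  a hypercube with linear size `l` is correctable if `4(w−1)D l^{D−1} < d`» (grown from single sites «with linear
  size `1 + 2(w−1), 1 + 4(w−1), …` … as long as `|A| < d`»). Theorem 1 (p0008 L1–26): «(Tradeoff Theorem for local
  subsystem codes) For a local subsystem code in `D ≥ 2` dimensions with interaction range `w > 1` and distance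
  `d ≫ w`, defined on a hypercubic lattice with linear size `L`, every dressed logical operator is equivalent to an
  operator with weight `d̃` satisfying `d̃ d^{1/(D−1)} < c L^D` … there exists a gauge operator `y_i` that “cleans”
  the logical operator in the hypercube `M_i` … `x̃ = x ∏_i y_i` is equivalent to `x` and supported on the
  complement of the union of hypercubes `M = ∪_i M_i`.» Setting §2 (p0004 L36): hypercubic lattice «with either
  open or periodic boundary conditions», each gauge generator inside a hypercube with `w^D` vertices.

THIS FILE PROVES, on the subsystem vocabulary of `SubsystemCodes.lean` and the torus partition of
`LocalCodeTradeoffTorus.lean` / `LocalCodeLogicalOperatorTradeoff.lean`: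

1. geometry-free: HP Lemma 4 (`IsGaugeCorrectable.union_of_crossing`, same proof as the tree's stabilizer
   `IsCorrectableRegion.union_of_crossing` with the subsystem Cleaning Lemma: the `M`-part of a cleaned bare logical
   operator is bare AND gauge, i.e. a stabilizer), Bravyi's «`l_bare(A) = 0`» for decoupled gauge-correctable
   blocks (`bareFree_of_fibers`), «`|B| ≥ k`» (`IsSubsystemCode.le_card_compl_of_bareFree`) and the cleaning bound
   `d ≤ |B|` (`IsSubsystemCode.dist_le_card_compl_of_bareFree`);
2. HP Lemma 5 on the torus: growth of gauge-correctable hypercubes (`gauge_cube_step`, `exists_gaugeCorrectable_cube`);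
3. ★ `Bravyi2011_kd_le_cn_torus (D w) (hD : 2 ≤ D) : ∃ c > 0, ∀ L n k d e G, HasLocalGeneratorsPeriodic e w G →
   IsSubsystemCode G k d → k · d^{1/(D−1)} ≤ c · n` — the `D`-dimensional form of Bravyi's §8 argument (the paper
   states `D = 2`: `Bravyi2011_kd_le_cn_torus_two`, `kd ≤ c n`; open boundaries `Bravyi2011_kd_le_cn`);
4. ★ `HaahPreskill2012_theorem1_torus` — Theorem 1 for SUBSYSTEM codes with range-`w` gauge generators: one region
   `Y` with `Ḡ ⊔ (S̄⊥ ⊓ 𝒫(Y)) = S̄⊥` (every dressed logical class has a gauge-equivalent representative on `Y`) and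
   `|Y| · d^{1/(D−1)} ≤ c · n` (+ open boundaries, per-operator reading).

Deliberately NOT here: Bravyi's stronger Eq. (1) `kd² = O(n)` when BOTH `𝒢` and `𝒮` have local generators (§8, second
half: needs the three-region partition with the stabilizer-local cleaning), his Theorems 1–3 (generalized Bacon–Shor
codes, existence via Gilbert–Varshamov), HP Thm. 2 (commuting-projector codes), constants.

## Mathlib / tree search

Tree: everything of `SubsystemCodes.lean`; `BPTTorus.{sh, cube, frame, mem_cube, mem_frame, card_cube_le, card_cube_eq,
card_frame_eq, subset_frame_of_crossing, exists_correctable_cube (stabilizer model), IsCorr, per, pstart,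
card_badFin_le}` (LocalCodeTradeoffTorus.lean); `HPTradeoff.{pureLab, InCorridor, pureLab_separated,
fiber_pureLab_subset_cube, isSome_pureLab_iff, card_filter_inCorridor_le, real_step}` (LocalCodeLogicalOperatorTradeoff.lean);
`proj_mem_sympDual_of_crossing`, `proj_fiber_mem_sympDual`, `eq_sum_proj_fiber`, `proj_fiber_none_eq_zero`,
`proj_compl_mem_supportedOn_compl_union`, `finrank_supportedOn_eq` (CorrectableRegions.lean).
-/

namespace Literature.InformationTheory.QuantumCodes

open Finset Module
open Classical

variable {n : ℕ}

/-! ### 1. Expansion and block union for gauge-correctable regions -/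

section Generic

variable {ι : Type*} (γ : ι → SympVec n) {G : Submodule (ZMod 2) (SympVec n)}

/-- **Haah–Preskill Lemma 4 (Expansion Lemma for local subsystem codes) — proved, generator form.** Let the gauge
space be `Ḡ = ⟨γ⟩`, `M` a gauge-correctable region and `F` a gauge-correctable region containing the boundary of `M`
in the sense that every gauge generator meeting both `M` and `M̄` is supported inside `F` (`∂M ⊆ A`, `F = A`). Then
`M ∪ F` is gauge-correctable. Proof (symplectic): a dressed `Q` on `M ∪ F` is shown to lie in `Ḡ = Ḡ⊥⊥`: clean a
bare `P ∈ Ḡ⊥` off `F` with a stabilizer (BT09 Lemma 2); the `M`-part of the remainder is bare (crossing generators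
live in `F`) hence, `M` being correctable, a gauge operator — so a stabilizer, orthogonal to `Q`; the rest lives off
`M ∪ F`. Column: proved theorem.
[cite: HaahPreskill2012, §4 Lemma 4 (p. 7: «if M and A are both correctable, where A contains ∂M, then M ∪ A is correctable»)] -/
theorem IsGaugeCorrectable.union_of_crossing (hG : G = Submodule.span (ZMod 2) (Set.range γ))
    {M F : Finset (Fin n)} (hM : IsGaugeCorrectable G M) (hF : IsGaugeCorrectable G F)
    (hcross : ∀ a, (∃ q ∈ sympSupport (γ a), q ∈ M) → (∃ q ∈ sympSupport (γ a), q ∉ M) →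
      ∀ q ∈ sympSupport (γ a), q ∈ F) :
    IsGaugeCorrectable G (M ∪ F) := by
  have hclean := sup_gaugeStabilizer_bare_compl_eq hF
  intro Q hQd hQs
  rw [← sympDual_sympDual G, mem_sympDual_iff]
  intro P hP
  rw [← hclean] at hP
  obtain ⟨s, hs, P', ⟨hP'd, hP'F⟩, rfl⟩ := Submodule.mem_sup.1 hP
  have h1 : sympInner s Q = 0 := (mem_sympDual_iff.1 hQd) s hs
  -- the M-part of P' is bare …
  have hMd : proj M P' ∈ sympDual G := by
    subst hG
    exact proj_mem_sympDual_of_crossing γ hcross hP'd hP'F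
  -- … and gauge (M is correctable), hence a stabilizer
  have hMS : proj M P' ∈ gaugeStabilizer G :=
    ⟨hM _ (sympDual_le_sympDual_gaugeStabilizer G hMd) (proj_mem_supportedOn M P'), hMd⟩
  have h2 : sympInner (proj M P') Q = 0 := (mem_sympDual_iff.1 hQd) _ hMS
  have h3 : sympInner (proj Mᶜ P') Q = 0 := by
    rw [sympInner_comm]
    exact sympInner_eq_zero_of_supportedOn_compl hQs (proj_compl_mem_supportedOn_compl_union hP'F)
  rw [sympInner_add_left, h1, zero_add, ← proj_add_proj_compl M P', sympInner_add_left, h2, h3, add_zero]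

/-- **«`l_bare(A) = 0`»**: if every gauge generator meets at most one block of the labelling `β` and every block is
gauge-correctable, no bare logical operator is supported on the union of the blocks: `Ḡ⊥ ∩ 𝒫(∪ blocks) ⊆ Ḡ`
(«`P_i ∈ 𝒞(𝒢)` for all `i` … `P_i` is a bare logical operator supported inside `A_i`. But this implies
`l(A_i) ≥ l_bare(A_i) > 0` which is a contradiction»). [cite: Bravyi2011Subsystem, §8 (p. 13, Eq. (Abare))] -/
theorem bareFree_of_fibers {κ : Type*} [DecidableEq κ] (β : Fin n → Option κ)
    (hG : G = Submodule.span (ZMod 2) (Set.range γ))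
    (hsep : ∀ a, ∀ q ∈ sympSupport (γ a), ∀ q' ∈ sympSupport (γ a), ∀ i i' : κ,
      β q = some i → β q' = some i' → i = i')
    (hcorr : ∀ i, IsGaugeCorrectable G (fiber β (some i))) :
    (sympDual G ⊓ supportedOn (univ.filter fun q => (β q).isSome) : Submodule (ZMod 2) (SympVec n)) ≤ G := by
  rintro P ⟨hPd, hPs⟩
  rw [eq_sum_proj_fiber β P]
  refine Submodule.sum_mem _ fun o _ => ?_
  rcases o with _ | i
  · rw [proj_fiber_none_eq_zero β hPs]; exact Submodule.zero_mem _
  · have hd : proj (fiber β (some i)) P ∈ sympDual G := by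
      subst hG
      exact proj_fiber_mem_sympDual β γ hsep hPd hPs i
    exact hcorr i _ (sympDual_le_sympDual_gaugeStabilizer G hd) (proj_mem_supportedOn _ P)

/-- **«`2|B| ≥ l(B) = 2k`, that is, `|B| ≥ k`»**: if no bare logical operator is supported on `M`, a subsystem code
with `k` logical qubits has `k ≤ |M̄|`. [cite: Bravyi2011Subsystem, §8 (p. 13: «Applying Lemma 2 we get l(B) = 2k. However, a subset B can support at most 2|B| independent Pauli operators»)] -/
theorem IsSubsystemCode.le_card_compl_of_bareFree {k d : ℕ} (h : IsSubsystemCode G k d) {M : Finset (Fin n)}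
    (hM : (sympDual G ⊓ supportedOn M : Submodule (ZMod 2) (SympVec n)) ≤ G) : k ≤ #Mᶜ := by
  have hcount := h.bareDressed_count M
  have heq : (sympDual G ⊓ supportedOn M : Submodule (ZMod 2) (SympVec n)) = gaugeStabilizer G ⊓ supportedOn M :=
    le_antisymm (fun v hv => ⟨⟨hM hv, hv.1⟩, hv.2⟩) (inf_le_inf_right _ (gaugeStabilizer_le_sympDual G))
  rw [heq] at hcount
  have hle := Submodule.finrank_mono
    (inf_le_right : (sympDual (gaugeStabilizer G) ⊓ supportedOn Mᶜ : Submodule (ZMod 2) (SympVec n)) ≤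
      supportedOn Mᶜ)
  rw [finrank_supportedOn_eq] at hle
  omega

/-- **Cleaning bound `d ≤ |M̄|`**: if no bare logical operator is supported on `M` and `k ≥ 1`, some dressed logical
operator lives on `M̄` (Lemma 3: clean one with a gauge operator), so `d ≤ |M̄|`.
[cite: HaahPreskill2012, §3 Lemma 3 and §5 («d ≤ d̃», p. 11)] -/
theorem IsSubsystemCode.dist_le_card_compl_of_bareFree {k d : ℕ} (h : IsSubsystemCode G k d) (hk : 1 ≤ k)
    {M : Finset (Fin n)} (hM : (sympDual G ⊓ supportedOn M : Submodule (ZMod 2) (SympVec n)) ≤ G) :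
    d ≤ #Mᶜ := by
  obtain ⟨P, hPd, hPG⟩ := exists_dressed_of_pos h hk
  obtain ⟨y, hy, hPy⟩ := exists_gauge_clean hM hPd
  have hd' : P + y ∈ sympDual (gaugeStabilizer G) :=
    Submodule.add_mem _ hPd (le_sympDual_gaugeStabilizer G hy)
  have hnot : P + y ∉ G := fun hin => hPG (by simpa using G.sub_mem hin hy)
  exact (h.2 _ hd' hnot).trans (sympWeight_le_card_of_mem hPy)

end Generic

/-! ### 2. Growing gauge-correctable hypercubes on the torus (Lemma 5) -/

namespace SubsystemTorus

open BPTTorus HPTradeoff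

section Growth

variable {D L : ℕ} {e : Fin n ≃ (Fin D → Fin L)} {ι : Type*} {γ : ι → SympVec n}
  {G : Submodule (ZMod 2) (SympVec n)} {t d : ℕ}

/-- Value of a difference in `Fin L`. [folklore] -/
private theorem val_sub_eq {L : ℕ} (y c : Fin L) :
    ((y - c : Fin L) : ℕ) = if (c : ℕ) ≤ y then (y : ℕ) - c else (y : ℕ) + L - c := by
  split_ifs with h
  · exact Fin.coe_sub_iff_le.2 h
  · rw [Fin.coe_sub_iff_lt.2 (Fin.lt_def.2 (by omega))]; omega

/-- `a^D − b^D ≤ (a − b)·D·a^{D−1}` for `b ≤ a` (telescoping; private copy of the helper of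
`LocalCodeTradeoffTorus.lean`). [folklore] -/
private theorem pow_sub_pow_le (a b : ℕ) (hab : b ≤ a) : ∀ D : ℕ, a ^ D - b ^ D ≤ (a - b) * (D * a ^ (D - 1))
  | 0 => by simp
  | D + 1 => by
    have ih := pow_sub_pow_le a b hab D
    rw [Nat.add_sub_cancel]
    apply Nat.sub_le_iff_le_add'.2
    rcases Nat.eq_zero_or_pos D with hD | hD
    · subst hD; simp; omega
    · have haD : a * a ^ (D - 1) = a ^ D := by
        rw [← pow_succ']; congr 1; omega
      have h1 : a ^ D ≤ b ^ D + (a - b) * (D * a ^ (D - 1)) := Nat.sub_le_iff_le_add'.1 ih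
      calc a ^ (D + 1) = a * a ^ D := by ring
        _ ≤ a * (b ^ D + (a - b) * (D * a ^ (D - 1))) := Nat.mul_le_mul_left _ h1
        _ = a * b ^ D + (a - b) * (D * (a * a ^ (D - 1))) := by ring
        _ = (b + (a - b)) * b ^ D + (a - b) * (D * a ^ D) := by rw [haD]; congr 1; rw [Nat.add_sub_cancel' hab]
        _ = b ^ (D + 1) + (a - b) * b ^ D + (a - b) * (D * a ^ D) := by ring
        _ ≤ b ^ (D + 1) + (a - b) * a ^ D + (a - b) * (D * a ^ D) := by gcongr
        _ = b ^ (D + 1) + (a - b) * ((D + 1) * a ^ (D + 1 - 1)) := by rw [Nat.add_sub_cancel]; ring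

/-- **One expansion step for gauge-correctable hypercubes** (Lemma 4 with `A` = the frame): gauge generators of
range `t + 1`, every cube of side `m` gauge-correctable, `m + 2t ≤ L`, frame of fewer than `d` qubits ⇒ every cube
of side `m + 2t` gauge-correctable. [cite: HaahPreskill2012, §4 (p. 7: «we may choose A ⊇ ∂M so that M ∪ A is a hypercube with linear size l … A is surely correctable provided |A| < d»)] -/
theorem gauge_cube_step (hG : G = Submodule.span (ZMod 2) (Set.range γ))
    (hγ : ∀ a, IsCubeLocalPeriodic e (t + 1) (γ a)) (hdist : HasSubsystemMinDist G d) (hL : 0 < L) {m : ℕ}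
    (hmL : m + 2 * t ≤ L) (hfr : (m + 2 * t) ^ D - (m - 2 * t) ^ D < d)
    (hcube : ∀ o, IsGaugeCorrectable G (cube e o m)) (o : Fin D → Fin L) :
    IsGaugeCorrectable G (cube e o (m + 2 * t)) := by
  haveI : NeZero L := ⟨hL.ne'⟩
  have htL : t < L := by omega
  let tF : Fin L := ⟨t, htL⟩
  let o' : Fin D → Fin L := fun j => o j + tF
  have hsh : ∀ q j, sh e o' q j = if t ≤ sh e o q j then sh e o q j - t else sh e o q j + L - t := by
    intro q j
    unfold sh
    have h1 : e q j - o' j = (e q j - o j) - tF := sub_add_eq_sub_sub _ _ _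
    rw [h1, val_sub_eq]
  have hinner : ∀ q, q ∈ cube e o' m ↔ ∀ j, t ≤ sh e o q j ∧ sh e o q j < t + m := by
    intro q
    rw [mem_cube]
    refine forall_congr' fun j => ?_
    rw [hsh q j]
    have : sh e o q j < L := Fin.isLt _
    split_ifs with h <;> omega
  have hF : IsGaugeCorrectable G (frame e o m t) :=
    IsGaugeCorrectable.of_card_lt hdist (lt_of_eq_of_lt (card_frame_eq hL o hmL) hfr)
  have hU := (hcube o').union_of_crossing γ hG hF (fun a hin hout => by
      refine subset_frame_of_crossing hL hmL (hγ a) o ?_ ?_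
      · obtain ⟨q, hq, hq'⟩ := hin
        exact ⟨q, hq, (hinner q).1 hq'⟩
      · obtain ⟨q, hq, hq'⟩ := hout
        exact ⟨q, hq, fun h => hq' ((hinner q).2 h)⟩)
  refine hU.mono ?_
  intro q hq
  rw [mem_cube] at hq
  rw [mem_union]
  by_cases h : ∀ j, t ≤ sh e o q j ∧ sh e o q j < t + m
  · exact Or.inl ((hinner q).2 h)
  · refine Or.inr (mem_frame.2 ⟨fun j => ?_, fun hdeep => h fun j => ?_⟩)
    · have := hq j; omega
    · have := hdeep j; have := hq j; omega

/-- **Haah–Preskill Lemma 5 (Holographic Principle for local subsystem codes), torus form — proved**: with gauge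
generators of range `t + 1` (`t ≥ 1`) and distance `d ≥ 2` there is a side `1 ≤ R ≤ L` such that every hypercube
of side `R` is gauge-correctable and either `d ≤ (R+2t)^D − (R−2t)^D` or `L < R + 2t` (growth from single sites
while the frames have fewer than `d` qubits and do not wrap). [cite: HaahPreskill2012, §4 Lemma 5 (p. 7: «a hypercube with linear size l is correctable if 4(w−1)D l^{D−1} < d»)] -/
theorem exists_gaugeCorrectable_cube (hG : G = Submodule.span (ZMod 2) (Set.range γ))
    (hγ : ∀ a, IsCubeLocalPeriodic e (t + 1) (γ a)) (hdist : HasSubsystemMinDist G d) (hL : 0 < L) (ht : 1 ≤ t)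
    (hd : 2 ≤ d) :
    ∃ R, 1 ≤ R ∧ R ≤ L ∧ (∀ o, IsGaugeCorrectable G (cube e o R)) ∧
      (d ≤ (R + 2 * t) ^ D - (R - 2 * t) ^ D ∨ L < R + 2 * t) := by
  have hex : ∃ j : ℕ, ¬ ((1 + 2 * t * j + 2 * t) ^ D - (1 + 2 * t * j - 2 * t) ^ D < d ∧
      1 + 2 * t * j + 2 * t ≤ L) := by
    refine ⟨L, fun h => ?_⟩
    have := h.2
    nlinarith
  have hind : ∀ j, j ≤ Nat.find hex → ∀ o, IsGaugeCorrectable G (cube e o (1 + 2 * t * j)) := by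
    intro j
    induction j with
    | zero =>
      intro _ o
      refine IsGaugeCorrectable.of_card_lt hdist ((card_cube_le hL o _).trans_lt ?_)
      simp only [mul_zero, add_zero, one_pow]
      omega
    | succ j ih =>
      intro hj o
      have hPj := not_not.1 (Nat.find_min hex (show j < Nat.find hex by omega))
      have := gauge_cube_step hG hγ hdist hL hPj.2 hPj.1 (ih (by omega)) o
      rwa [show 1 + 2 * t * (j + 1) = 1 + 2 * t * j + 2 * t by ring]
  refine ⟨1 + 2 * t * Nat.find hex, by omega, ?_, hind _ le_rfl, ?_⟩
  · rcases Nat.eq_zero_or_pos (Nat.find hex) with h0 | hpos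
    · rw [h0]; omega
    · have hPj := not_not.1 (Nat.find_min hex (show Nat.find hex - 1 < Nat.find hex by omega))
      have h2 := hPj.2
      have : 2 * t * Nat.find hex = 2 * t * (Nat.find hex - 1) + 2 * t := by
        rw [← Nat.mul_succ]; congr 1; omega
      omega
  · have hP := Nat.find_spec hex
    rw [not_and_or, not_lt, not_le] at hP
    exact hP

end Growth

/-! ### 3. The partition: pure blocks are bare-free -/

section Partition

variable {D L : ℕ} {e : Fin n ≃ (Fin D → Fin L)} {Q t : ℕ} {ι : Type*} {γ : ι → SympVec n}
  {G : Submodule (ZMod 2) (SympVec n)}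

/-- **`l_bare(A) = 0` for the pure blocks of the torus partition**: with gauge generators of range `t + 1`, blocks of
period `R + t ≥ L/Q` and every side-`R` hypercube gauge-correctable, no bare logical operator lives on the union of
the pure blocks. [cite: Bravyi2011Subsystem, §8 (p. 13, Eq. (Abare))] -/
theorem bareFree_blocks (hG : G = Submodule.span (ZMod 2) (Set.range γ))
    (hγ : ∀ a, IsCubeLocalPeriodic e (t + 1) (γ a)) (hQ : 0 < Q) (hL : 0 < L) {R : ℕ}
    (hLQ : L ≤ Q * (R + t)) (hcube : ∀ o, IsGaugeCorrectable G (cube e o R)) :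
    (sympDual G ⊓ supportedOn (univ.filter fun q => ¬ InCorridor e Q t q) :
      Submodule (ZMod 2) (SympVec n)) ≤ G := by
  have h := bareFree_of_fibers γ (pureLab e Q t) hG (fun a => pureLab_separated (hγ a))
    (fun P => by
      obtain ⟨o, ho⟩ := fiber_pureLab_subset_cube (e := e) (t := t) hQ hL hLQ P
      exact (hcube o).mono ho)
  have hset : (univ.filter fun q => ¬ InCorridor e Q t q) = univ.filter fun q => (pureLab e Q t q).isSome := by
    ext q
    simp only [mem_filter, mem_univ, true_and]
    exact (isSome_pureLab_iff (e := e) (Q := Q) (t := t) (q := q)).symm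
  rw [hset]
  exact h

end Partition

/-! ### 4. Assembly -/

section Assembly

variable {D L : ℕ}

/-- **The integer form on the torus, subsystem version.** For a subsystem code with `k ≥ 1` on `(ℤ/L)^D`, `D ≥ 2`,
whose GAUGE space is spanned by generators of range `t + 1` (`t ≥ 1`), there are a region `Y` with no bare logical
operator on `Ȳ` (so every dressed logical operator is a gauge operator away from one on `Y`, and `k ≤ |Y|`) and a
length `M ≥ 1` with `|Y| · M ≤ 6tD · n` and `d ≤ C_B(t,D) · M^{D−1}`.
[cite: Bravyi2011Subsystem, §8 (p. 13: «|B| = O(n/R) = O(n/d)»); HaahPreskill2012, §4 proof of Thm. 1] -/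
theorem exists_region {k d t : ℕ} (hD : 2 ≤ D) (ht : 1 ≤ t) (e : Fin n ≃ (Fin D → Fin L))
    {G : Submodule (ZMod 2) (SympVec n)} (hloc : HasLocalGeneratorsPeriodic e (t + 1) G)
    (hcode : IsSubsystemCode G k d) (hk : 1 ≤ k) :
    ∃ (Y : Finset (Fin n)) (M : ℕ),
      (sympDual G ⊓ supportedOn Yᶜ : Submodule (ZMod 2) (SympVec n)) ≤ G ∧ 1 ≤ M ∧
      #Y * M ≤ 6 * t * D * n ∧
      d ≤ (4 * t * D * 2 ^ (D - 1) + (6 * t) ^ D + 4 * t * D * (7 * t) ^ (D - 1) + 1) * M ^ (D - 1) := by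
  set CB := 4 * t * D * 2 ^ (D - 1) + (6 * t) ^ D + 4 * t * D * (7 * t) ^ (D - 1) + 1 with hCB
  have hn : n = L ^ D := by
    have h := Fintype.card_congr e
    simpa using h
  have hCA1 : 1 ≤ 6 * t * D := by nlinarith
  have huniv : #(univ : Finset (Fin n)) = n := by rw [card_univ, Fintype.card_fin]
  -- Y = everything is always admissible (Ȳ = ∅ supports nothing)
  have hfree_univ : (sympDual G ⊓ supportedOn (univ : Finset (Fin n))ᶜ : Submodule (ZMod 2) (SympVec n)) ≤ G := by
    rintro v ⟨-, hv⟩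
    have h0 : v = 0 := by
      ext i
      · exact (hv i (by simp)).1
      · exact (hv i (by simp)).2
    rw [h0]; exact G.zero_mem
  have triv : ∀ {B : ℕ}, d ≤ B → B ≤ CB →
      ∃ (Y : Finset (Fin n)) (M : ℕ), (sympDual G ⊓ supportedOn Yᶜ : Submodule (ZMod 2) (SympVec n)) ≤ G ∧
        1 ≤ M ∧ #Y * M ≤ 6 * t * D * n ∧ d ≤ CB * M ^ (D - 1) := by
    intro B hdB hB
    refine ⟨univ, 1, hfree_univ, le_rfl, ?_, ?_⟩
    · rw [huniv, mul_one]
      exact Nat.le_mul_of_pos_left n hCA1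
    · rw [one_pow, mul_one]; exact hdB.trans hB
  -- k ≤ n and d ≤ n
  have hkn : k ≤ n := by
    have h1 := hcode.1
    have h2 := finrank_sympDual_add G
    omega
  have hn1 : 1 ≤ n := hk.trans hkn
  have hL : 0 < L := by
    rcases Nat.eq_zero_or_pos L with h | h
    · exfalso; rw [h, zero_pow (by omega)] at hn; omega
    · exact h
  have hdn : d ≤ n := by
    have h := hcode.dist_le_card_compl_of_bareFree hk (M := (∅ : Finset (Fin n)))
      (by rintro v ⟨-, hv⟩
          have h0 : v = 0 := by
            ext i
            · exact (hv i (by simp)).1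
            · exact (hv i (by simp)).2
          rw [h0]; exact G.zero_mem)
    simpa using h
  -- the local gauge generators
  set T : Set (SympVec n) := {v | v ∈ G ∧ IsCubeLocalPeriodic e (t + 1) v} with hT
  have hG : G = Submodule.span (ZMod 2) (Set.range (Subtype.val : T → SympVec n)) := by
    rw [Subtype.range_coe]
    exact le_antisymm hloc (Submodule.span_le.2 fun v hv => hv.1)
  have hγ : ∀ a : T, IsCubeLocalPeriodic e (t + 1) (a : SympVec n) := fun a => a.2.2
  -- d ≤ 1
  rcases Nat.lt_or_ge d 2 with hd | hd
  · exact triv (B := 1) (by omega) (by omega)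
  -- tiny torus
  by_cases hLt : L < 6 * t
  · refine triv hdn ?_
    have : L ^ D ≤ (6 * t) ^ D := Nat.pow_le_pow_left hLt.le D
    rw [hn]; omega
  rw [not_lt] at hLt
  -- growth
  obtain ⟨R, hR1, hRL, hcube, halt⟩ := exists_gaugeCorrectable_cube hG hγ hcode.2 hL ht hd
  have hLD : L ^ (D - 1) * L = L ^ D := by rw [← pow_succ]; congr 1; omega
  rcases halt with hdR | hbig
  swap
  · -- the blocks have outgrown the torus: one hypercube
    set M₀ : Finset (Fin n) := cube e (fun _ => ⟨0, hL⟩) R with hM₀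
    have hfree : (sympDual G ⊓ supportedOn M₀ : Submodule (ZMod 2) (SympVec n)) ≤ G :=
      fun v hv => hcube _ v (sympDual_le_sympDual_gaugeStabilizer G hv.1) hv.2
    have hcard : #M₀ᶜ = n - R ^ D := by
      rw [card_compl, Fintype.card_fin, hM₀, card_cube_eq hL _ hRL]
    have h2 : n - R ^ D ≤ L ^ D - (L - 2 * t) ^ D := by
      rw [hn]
      exact Nat.sub_le_sub_left (Nat.pow_le_pow_left (by omega) D) _
    have h3 : L ^ D - (L - 2 * t) ^ D ≤ 2 * t * (D * L ^ (D - 1)) := by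
      have h := pow_sub_pow_le L (L - 2 * t) (Nat.sub_le _ _) D
      rwa [show L - (L - 2 * t) = 2 * t by omega] at h
    have h23 : n - R ^ D ≤ 2 * t * (D * L ^ (D - 1)) := h2.trans h3
    refine ⟨M₀ᶜ, L, by rw [compl_compl]; exact hfree, hL, ?_, ?_⟩
    · rw [hcard]
      calc (n - R ^ D) * L ≤ 2 * t * (D * L ^ (D - 1)) * L := Nat.mul_le_mul_right _ h23
        _ = 2 * t * D * (L ^ (D - 1) * L) := by ring
        _ = 2 * t * D * n := by rw [hLD, hn]
        _ ≤ 6 * t * D * n := by gcongr; norm_num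
    · have h1 := hcode.dist_le_card_compl_of_bareFree hk hfree
      rw [hcard] at h1
      have hcb : 2 * t * D ≤ CB := by
        have h2D : 1 ≤ 2 ^ (D - 1) := Nat.one_le_two_pow
        have : 2 * t * D ≤ 4 * t * D * 2 ^ (D - 1) :=
          calc 2 * t * D ≤ 4 * t * D := Nat.mul_le_mul_right _ (by omega)
            _ = 4 * t * D * 1 := (mul_one _).symm
            _ ≤ 4 * t * D * 2 ^ (D - 1) := Nat.mul_le_mul_left _ h2D
        omega
      calc d ≤ n - R ^ D := h1
        _ ≤ 2 * t * (D * L ^ (D - 1)) := h23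
        _ = (2 * t * D) * L ^ (D - 1) := by ring
        _ ≤ CB * L ^ (D - 1) := Nat.mul_le_mul_right _ hcb
  · -- the frame count has reached d: d ≤ 4tD (R+2t)^(D-1)
    have hd4 : d ≤ 4 * t * (D * (R + 2 * t) ^ (D - 1)) :=
      hdR.trans ((pow_sub_pow_le _ _ (by omega) D).trans (Nat.mul_le_mul_right _ (by omega)))
    by_cases hR5 : R < 5 * t
    · refine triv hd4 ?_
      have : (R + 2 * t) ^ (D - 1) ≤ (7 * t) ^ (D - 1) := Nat.pow_le_pow_left (by omega) _
      calc 4 * t * (D * (R + 2 * t) ^ (D - 1)) ≤ 4 * t * (D * (7 * t) ^ (D - 1)) := by gcongr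
        _ = 4 * t * D * (7 * t) ^ (D - 1) := by ring
        _ ≤ CB := by omega
    rw [not_lt] at hR5
    -- the partition with Q = ⌈L/p⌉ near-equal periods, p = R + t
    set p := R + t with hp
    have hp0 : 0 < p := by omega
    set Q := (L + p - 1) / p with hQdef
    have hQ1 : 1 ≤ Q := by
      rw [hQdef, Nat.le_div_iff_mul_le hp0]; omega
    have hdm := Nat.div_add_mod (L + p - 1) p
    have hml := Nat.mod_lt (L + p - 1) hp0
    have hLQ : L ≤ Q * p := by
      have : p * ((L + p - 1) / p) = Q * p := by rw [hQdef]; ring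
      omega
    have hQp : Q * p < L + p := by
      have : p * ((L + p - 1) / p) = Q * p := by rw [hQdef]; ring
      omega
    have hQone : L ≤ p → Q = 1 := by
      intro hpL
      have : Q < 2 := by
        by_contra h
        rw [not_lt] at h
        have : 2 * p ≤ Q * p := Nat.mul_le_mul_right _ h
        omega
      omega
    have h2Q : 2 * t * Q ≤ L := by
      rcases Nat.lt_or_ge p L with hpL | hpL
      · have h1 : 2 * t * (L + p) ≤ L * p :=
          calc 2 * t * (L + p) ≤ 2 * t * (L + L) := Nat.mul_le_mul_left _ (by omega)
            _ = (4 * t) * L := by ring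
            _ ≤ p * L := Nat.mul_le_mul_right _ (by omega)
            _ = L * p := by ring
        have h3 : 2 * t * Q * p < L * p :=
          calc 2 * t * Q * p = 2 * t * (Q * p) := by ring
            _ < 2 * t * (L + p) := Nat.mul_lt_mul_of_pos_left hQp (by omega)
            _ ≤ L * p := h1
        exact le_of_lt (Nat.lt_of_mul_lt_mul_right h3)
      · rw [hQone hpL]; omega
    have hQ0 : 0 < Q := hQ1
    -- the region Y = corridor qubits; its complement (pure blocks) is bare-free
    set Y : Finset (Fin n) := univ.filter fun q => InCorridor e Q t q with hYdef
    have hYc : Yᶜ = univ.filter fun q => ¬ InCorridor e Q t q := by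
      ext q; simp [hYdef]
    have hfree : (sympDual G ⊓ supportedOn Yᶜ : Submodule (ZMod 2) (SympVec n)) ≤ G := by
      rw [hYc]
      exact bareFree_blocks (e := e) (Q := Q) (t := t) hG hγ hQ0 hL hLQ hcube
    have hYcard : #Y ≤ D * (3 * t * Q) * L ^ (D - 1) :=
      card_filter_inCorridor_le (e := e) hQ0 hL h2Q
    rcases Nat.lt_or_ge p L with hpL | hpL
    · -- at least one full period: M = p
      refine ⟨Y, p, hfree, hp0, ?_, ?_⟩
      · have hQp2 : Q * p ≤ 2 * L := by omega
        calc #Y * p ≤ D * (3 * t * Q) * L ^ (D - 1) * p := Nat.mul_le_mul_right _ hYcard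
          _ = 3 * t * D * (Q * p) * L ^ (D - 1) := by ring
          _ ≤ 3 * t * D * (2 * L) * L ^ (D - 1) := by gcongr
          _ = 6 * t * D * (L ^ (D - 1) * L) := by ring
          _ = 6 * t * D * n := by rw [hLD, hn]
      · have h1 : (R + 2 * t) ^ (D - 1) ≤ (2 * p) ^ (D - 1) := Nat.pow_le_pow_left (by omega) _
        calc d ≤ 4 * t * (D * (R + 2 * t) ^ (D - 1)) := hd4
          _ ≤ 4 * t * (D * (2 * p) ^ (D - 1)) := by gcongr
          _ = (4 * t * D * 2 ^ (D - 1)) * p ^ (D - 1) := by rw [mul_pow]; ring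
          _ ≤ CB * p ^ (D - 1) := Nat.mul_le_mul_right _ (by omega)
    · -- less than one period: M = L
      have hQ1' := hQone hpL
      refine ⟨Y, L, hfree, hL, ?_, ?_⟩
      · calc #Y * L ≤ D * (3 * t * Q) * L ^ (D - 1) * L := Nat.mul_le_mul_right _ hYcard
          _ = 3 * t * D * Q * (L ^ (D - 1) * L) := by ring
          _ = 3 * (t * D * n) := by rw [hLD, hn, hQ1']; ring
          _ ≤ 6 * (t * D * n) := Nat.mul_le_mul_right _ (by norm_num)
          _ = 6 * t * D * n := by ring
      · have h1 : (R + 2 * t) ^ (D - 1) ≤ (2 * L) ^ (D - 1) := Nat.pow_le_pow_left (by omega) _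
        calc d ≤ 4 * t * (D * (R + 2 * t) ^ (D - 1)) := hd4
          _ ≤ 4 * t * (D * (2 * L) ^ (D - 1)) := by gcongr
          _ = (4 * t * D * 2 ^ (D - 1)) * L ^ (D - 1) := by rw [mul_pow]; ring
          _ ≤ CB * L ^ (D - 1) := Nat.mul_le_mul_right _ (by omega)

end Assembly

end SubsystemTorus

/-! ### The theorems -/

/-- **Bravyi 2011, Eq. (2) `kd = O(n)`, in the `D`-dimensional torus form `k · d^{1/(D−1)} ≤ c(w, D) · n` — proved.**
For every `D ≥ 2` and range `w` there is `c > 0` such that every subsystem code on the torus `(ℤ/L)^D` (qubits placed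
by `e`) whose GAUGE space is spanned by elements each inside a hypercube with `w^D` vertices (mod `L`), with `k`
logical qubits and dressed distance `≥ d`, satisfies `k · d^{1/(D−1)} ≤ c · n`. Bravyi prints the case `D = 2`
(`kd = O(n)`, «2D subsystem codes whose gauge group has spatially local generators»); the proof here is his §8
argument (blocks with `l(A_i) = 0` by the holographic Lemma 5 of Haah–Preskill, decoupled ⇒ `l_bare(A) = 0` ⇒
`l(B) = 2k ≤ 2|B|`, `|B| = O(n/R)`) run in `D` dimensions on the near-equal cyclic periods of the BPT partition.
Column: proved theorem (the `D`-dimensional statement is this file's reading of the printed 2D proof).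
[cite: Bravyi2011Subsystem, §1 Eq. (2) (p. 4) and §8 «Proof of the upper bound» (p. 13); HaahPreskill2012, §4 Lemma 5] -/
theorem Bravyi2011_kd_le_cn_torus (D w : ℕ) (hD : 2 ≤ D) :
    ∃ c : ℝ, 0 < c ∧ ∀ (L n k d : ℕ) (e : Fin n ≃ (Fin D → Fin L)) (G : Submodule (ZMod 2) (SympVec n)),
      HasLocalGeneratorsPeriodic e w G → IsSubsystemCode G k d →
        (k : ℝ) * (d : ℝ) ^ ((1 : ℝ) / ((D : ℝ) - 1)) ≤ c * n := by
  obtain ⟨t, ht, hwt⟩ : ∃ t : ℕ, 1 ≤ t ∧ w ≤ t + 1 := ⟨max w 2 - 1, by omega, by omega⟩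
  refine ⟨((6 * t * D : ℕ) : ℝ) *
      ((4 * t * D * 2 ^ (D - 1) + (6 * t) ^ D + 4 * t * D * (7 * t) ^ (D - 1) + 1 : ℕ) : ℝ) ^
        ((1 : ℝ) / ((D : ℝ) - 1)), ?_, ?_⟩
  · have hCA : (0 : ℝ) < ((6 * t * D : ℕ) : ℝ) := by
      exact_mod_cast (show 0 < 6 * t * D by nlinarith)
    have hCB : (0 : ℝ) < ((4 * t * D * 2 ^ (D - 1) + (6 * t) ^ D + 4 * t * D * (7 * t) ^ (D - 1) + 1 : ℕ) : ℝ) := by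
      exact_mod_cast Nat.succ_pos _
    positivity
  · intro L n k d e G hloc hcode
    rcases Nat.eq_zero_or_pos k with hk | hk
    · rw [hk, Nat.cast_zero, zero_mul]
      positivity
    · obtain ⟨Y, M, hfree, -, h1, h2⟩ := SubsystemTorus.exists_region hD ht e (hloc.mono hwt) hcode hk
      have hkY : k ≤ #Y := by
        have := hcode.le_card_compl_of_bareFree hfree
        rwa [compl_compl] at this
      have h1' : k * M ≤ 6 * t * D * n := (Nat.mul_le_mul_right _ hkY).trans h1
      exact HPTradeoff.real_step hD h1' h2

/-- **Bravyi 2011, Eq. (2) as printed (`D = 2`): `kd ≤ c(w) · n`** for subsystem codes on the `L × L` torus whose gauge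
space has range-`w` generators. [cite: Bravyi2011Subsystem, §1 Eq. (2) (p. 4: «a new upper bound on the parameters of 2D subsystem codes whose gauge group has spatially local generators, namely, kd = O(n)»), proof §8] -/
theorem Bravyi2011_kd_le_cn_torus_two (w : ℕ) :
    ∃ c : ℝ, 0 < c ∧ ∀ (L n k d : ℕ) (e : Fin n ≃ (Fin 2 → Fin L)) (G : Submodule (ZMod 2) (SympVec n)),
      HasLocalGeneratorsPeriodic e w G → IsSubsystemCode G k d → (k : ℝ) * (d : ℝ) ≤ c * n := by
  obtain ⟨c, hc, h⟩ := Bravyi2011_kd_le_cn_torus 2 w le_rfl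
  refine ⟨c, hc, fun L n k d e G hloc hcode => ?_⟩
  have key := h L n k d e G hloc hcode
  have hexp : (1 : ℝ) / (((2 : ℕ) : ℝ) - 1) = ((1 : ℕ) : ℝ) := by norm_num
  rw [hexp, Real.rpow_natCast, pow_one] at key
  exact key

/-- **Bravyi 2011, Eq. (2), open boundary conditions** (gauge generators inside hypercubes with `w^D` vertices of
`{1,…,L}^D`): `k · d^{1/(D−1)} ≤ c · n`. [cite: Bravyi2011Subsystem, §1 Eq. (2) and §8; HaahPreskill2012, §2 («open or periodic boundary conditions»)] -/
theorem Bravyi2011_kd_le_cn (D w : ℕ) (hD : 2 ≤ D) :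
    ∃ c : ℝ, 0 < c ∧ ∀ (L n k d : ℕ) (e : Fin n ≃ (Fin D → Fin L)) (G : Submodule (ZMod 2) (SympVec n)),
      HasLocalGenerators e w G → IsSubsystemCode G k d →
        (k : ℝ) * (d : ℝ) ^ ((1 : ℝ) / ((D : ℝ) - 1)) ≤ c * n := by
  obtain ⟨c, hc, h⟩ := Bravyi2011_kd_le_cn_torus D w hD
  exact ⟨c, hc, fun L n k d e G hloc hcode => h L n k d e G hloc.toPeriodic hcode⟩

/-- **Haah–Preskill 2012, Theorem 1, for SUBSYSTEM codes on the `D`-dimensional torus — proved.** «For a local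
subsystem code in `D ≥ 2` dimensions with interaction range `w > 1` … every dressed logical operator is equivalent
to an operator with weight `d̃` satisfying `d̃ d^{1/(D−1)} < c L^D`.» Typed: for every gauge space `Ḡ` on `(ℤ/L)^D`
spanned by range-`w` elements, `k` logical qubits, dressed distance `≥ d`, there is ONE region `Y` (the complement of
the union of the gauge-correctable hypercubes) with `Ḡ ⊔ (S̄⊥ ⊓ 𝒫(Y)) = S̄⊥` — every dressed logical operator is
equivalent modulo the gauge group to one supported on `Y` — and `|Y| · d^{1/(D−1)} ≤ c(w, D) · n`. Column: proved
theorem. -- TODO(general form): commuting-projector codes (Thm. 2).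
[cite: HaahPreskill2012, §4 Thm. 1 (p. 8) with its proof and §2 (periodic boundary conditions)] -/
theorem HaahPreskill2012_theorem1_torus (D w : ℕ) (hD : 2 ≤ D) :
    ∃ c : ℝ, 0 < c ∧ ∀ (L n k d : ℕ) (e : Fin n ≃ (Fin D → Fin L)) (G : Submodule (ZMod 2) (SympVec n)),
      HasLocalGeneratorsPeriodic e w G → IsSubsystemCode G k d →
        ∃ Y : Finset (Fin n), G ⊔ (sympDual (gaugeStabilizer G) ⊓ supportedOn Y) = sympDual (gaugeStabilizer G) ∧
          (#Y : ℝ) * (d : ℝ) ^ ((1 : ℝ) / ((D : ℝ) - 1)) ≤ c * n := by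
  obtain ⟨t, ht, hwt⟩ : ∃ t : ℕ, 1 ≤ t ∧ w ≤ t + 1 := ⟨max w 2 - 1, by omega, by omega⟩
  refine ⟨((6 * t * D : ℕ) : ℝ) *
      ((4 * t * D * 2 ^ (D - 1) + (6 * t) ^ D + 4 * t * D * (7 * t) ^ (D - 1) + 1 : ℕ) : ℝ) ^
        ((1 : ℝ) / ((D : ℝ) - 1)), ?_, ?_⟩
  · have hCA : (0 : ℝ) < ((6 * t * D : ℕ) : ℝ) := by
      exact_mod_cast (show 0 < 6 * t * D by nlinarith)
    have hCB : (0 : ℝ) < ((4 * t * D * 2 ^ (D - 1) + (6 * t) ^ D + 4 * t * D * (7 * t) ^ (D - 1) + 1 : ℕ) : ℝ) := by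
      exact_mod_cast Nat.succ_pos _
    positivity
  · intro L n k d e G hloc hcode
    rcases Nat.eq_zero_or_pos k with hk | hk
    · -- no logical qubits: S̄⊥ = Ḡ, take Y = ∅
      subst hk
      refine ⟨∅, ?_, ?_⟩
      · have hGe : sympDual (gaugeStabilizer G) = G := by
          refine le_antisymm ?_ (le_sympDual_gaugeStabilizer G)
          by_contra hlt
          have hne : ∃ P ∈ sympDual (gaugeStabilizer G), P ∉ G := by
            by_contra h; push Not at h; exact hlt h
          obtain ⟨P, hPd, hPG⟩ := hne
          have h1 := hcode.1
          have h2 := finrank_sympDual_add G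
          have h3 := finrank_sympDual_add (gaugeStabilizer G)
          have h4 : Module.finrank (ZMod 2) G < Module.finrank (ZMod 2) (sympDual (gaugeStabilizer G)) :=
            Submodule.finrank_lt_finrank_of_lt
              (lt_of_le_of_ne (le_sympDual_gaugeStabilizer G) fun h => hPG (h ▸ hPd))
          omega
        rw [hGe]
        exact sup_eq_left.2 inf_le_left
      · rw [card_empty, Nat.cast_zero, zero_mul]
        positivity
    · obtain ⟨Y, M, hfree, -, h1, h2⟩ := SubsystemTorus.exists_region hD ht e (hloc.mono hwt) hcode hk
      refine ⟨Y, ?_, HPTradeoff.real_step hD h1 h2⟩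
      have h := sup_gauge_dressed_compl_eq hfree
      rwa [compl_compl] at h

/-- **Haah–Preskill Theorem 1, subsystem codes — the printed per-operator reading**: every dressed logical operator
`x ∈ S̄⊥` has a gauge-equivalent `x̃` (`x̃ − x ∈ Ḡ`) of weight `d̃ = wt(x̃)` with `d̃ · d^{1/(D−1)} ≤ c(w,D) · n`.
[cite: HaahPreskill2012, §4 Thm. 1 (p. 8: «every dressed logical operator is equivalent to an operator with weight d̃ satisfying d̃ d^{1/(D−1)} < c L^D»)] -/
theorem HaahPreskill2012_theorem1_torus' (D w : ℕ) (hD : 2 ≤ D) :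
    ∃ c : ℝ, 0 < c ∧ ∀ (L n k d : ℕ) (e : Fin n ≃ (Fin D → Fin L)) (G : Submodule (ZMod 2) (SympVec n)),
      HasLocalGeneratorsPeriodic e w G → IsSubsystemCode G k d →
        ∀ x ∈ sympDual (gaugeStabilizer G), ∃ x' ∈ sympDual (gaugeStabilizer G), x' - x ∈ G ∧
          (sympWeight x' : ℝ) * (d : ℝ) ^ ((1 : ℝ) / ((D : ℝ) - 1)) ≤ c * n := by
  obtain ⟨c, hc, h⟩ := HaahPreskill2012_theorem1_torus D w hD
  refine ⟨c, hc, fun L n k d e G hloc hcode x hx => ?_⟩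
  obtain ⟨Y, hclean, hY⟩ := h L n k d e G hloc hcode
  have hx' : x ∈ G ⊔ (sympDual (gaugeStabilizer G) ⊓ supportedOn Y) := by rw [hclean]; exact hx
  obtain ⟨y, hy, x', ⟨hx'd, hx'Y⟩, rfl⟩ := Submodule.mem_sup.1 hx'
  refine ⟨x', hx'd, ?_, ?_⟩
  · have : x' - (y + x') = -y := by abel
    rw [this]
    exact G.neg_mem hy
  · calc (sympWeight x' : ℝ) * (d : ℝ) ^ ((1 : ℝ) / ((D : ℝ) - 1))
        ≤ (#Y : ℝ) * (d : ℝ) ^ ((1 : ℝ) / ((D : ℝ) - 1)) := by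
          refine mul_le_mul_of_nonneg_right ?_ (by positivity)
          exact_mod_cast sympWeight_le_card_of_mem hx'Y
      _ ≤ c * n := hY

/-- **Haah–Preskill Theorem 1, subsystem codes, open boundary conditions.** [cite: HaahPreskill2012, §4 Thm. 1 with §2 («with either open or periodic boundary conditions»)] -/
theorem HaahPreskill2012_theorem1 (D w : ℕ) (hD : 2 ≤ D) :
    ∃ c : ℝ, 0 < c ∧ ∀ (L n k d : ℕ) (e : Fin n ≃ (Fin D → Fin L)) (G : Submodule (ZMod 2) (SympVec n)),
      HasLocalGenerators e w G → IsSubsystemCode G k d →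
        ∃ Y : Finset (Fin n), G ⊔ (sympDual (gaugeStabilizer G) ⊓ supportedOn Y) = sympDual (gaugeStabilizer G) ∧
          (#Y : ℝ) * (d : ℝ) ^ ((1 : ℝ) / ((D : ℝ) - 1)) ≤ c * n := by
  obtain ⟨c, hc, h⟩ := HaahPreskill2012_theorem1_torus D w hD
  exact ⟨c, hc, fun L n k d e G hloc hcode => h L n k d e G hloc.toPeriodic hcode⟩

end Literature.InformationTheory.QuantumCodes
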